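import Literature.NumberTheory.Transcendental.RoySmallValueFactorization
import Literature.NumberTheory.Transcendental.RoySmallValuePhiMult
import Literature.NumberTheory.Transcendental.RoySmallValueDivision
import Literature.NumberTheory.Transcendental.RoySmallValueDistanceForms
import Mathlib.Algebra.Polynomial.Roots
import HarnessLib

/-!
# Roy's small value estimate for `𝔾ₐ × 𝔾ₘ` — Proposition 3.6 (ii) and the multiplicity `e₁ ≥ T` of Proposition 6.4

Topic `Literature/NumberTheory/Transcendental`. Part of the formalisation of the proof of Roy 2013,
Theorem 1.1 (named fact `roy2013_thm_1_1`, `RoySmallValueEstimates.lean`). Source: D. Roy,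
*A small value estimate for `𝔾ₐ × 𝔾ₘ`*, Mathematika 59 (2013) 333–363 = arXiv:1301.0663, §3,
Proposition 3.6 (p. 10) and §6, proof of Proposition 6.4 (p. 17):

> **Proposition 3.6.** Let `γ = (ξ, η) ∈ 𝒢`, let `D, T ∈ ℕ*` with `T ≤ binom(D+1, 2)`. [...]
> Moreover, for any finite set of points `S` of `ℙ²(ℂ)` not containing `(1:ξ:η)`, there exists an
> element of `I_D^{(γ,T)}` which does not vanish at any point of `S`.
>
> [...] there exists a polynomial `R` in `I_D^{(α,T)}` such that `R(αᵢ) ≠ 0` for `i = 2, …, t`.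
> Since `P` and `Q` also belong to `I_D^{(α,T)}`, Corollary 5.7 shows that the resultant in degree
> `D` vanishes to order at least `T` at the point `(P, Q, R)`. [...] Choosing `S` so that
> `S(α₁) ≠ 0`, [...] `F(R + zS) = a S(α₁)^{e₁} R(α₂)^{e₂} ⋯ R(α_t)^{e_t} z^{e₁} + O(z^{e₁+1})`, and
> therefore `e₁ ≥ T`.

We prove Proposition 3.6 (ii) (`exists_mem_vanIdeal_forall_eval_ne_zero`, from Lemma 3.5 with
`K = N − 1` as in the printed proof of 3.6 (i), the elements `(X₁ − ξX₀)^T X_k^{N−T}` of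
`I^{(γ,T)}`, and avoidance of finitely many hyperplanes in the vector space `I_D^{(γ,T)}`), and
the displayed multiplicity argument for `F = Φ(P, Q, ·)` (`le_mult_of_mem_vanIdeal`): if `P, Q`
lie in `I^{(α,T)}` for a point `α = αᵢ` of `𝒵(P, Q)` with `α₀α₂ ≠ 0`, then `T ≤ eᵢ` in the
factorisation `F = c ∏ ℓ_{αⱼ}^{eⱼ}` of `RoySmallValueFactorization`. Everything is proved; no
named facts.

## References

* [Roy2013] D. Roy, *A small value estimate for 𝔾ₐ × 𝔾ₘ*, Mathematika 59 (2013), 333–363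
  (arXiv:1301.0663), Proposition 3.6 (ii); §6, proof of Proposition 6.4.
-/

noncomputable section

open MvPolynomial Finset Module

namespace Literature.NumberTheory.Transcendental

namespace Roy2013

variable {D : ℕ} {M₁ M₂ : Finset (Fin 3 →₀ ℕ)}

/-! ### Proposition 3.6 (ii): elements of `I_D^{(γ,T)}` avoiding finitely many points -/

/-- If every element of `I_D^{(γ,T)}` vanishes at `β` then so does every homogeneous element of
`I^{(γ,T)}` of degree `≥ D` (Lemma 3.5 with `K = N − 1`, i.e. Proposition 3.6 (i)).
[cite: Roy2013, Proposition 3.6 (i) and its proof] -/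
theorem eval_eq_zero_of_forall_deg {ξ η : ℂ} (hη : η ≠ 0) {L T : ℕ} (hT₁ : (L + 1).choose 2 < T)
    (hT₂ : T ≤ (L + 2).choose 2) (hLD : L < D) {β : Fin 3 → ℂ}
    (H : ∀ R : CX, R.IsHomogeneous D → R ∈ vanIdeal ξ η T → eval β R = 0) :
    ∀ (n : ℕ) (R : CX), R.IsHomogeneous (D + n) → R ∈ vanIdeal ξ η T → eval β R = 0 := by
  intro n
  induction n with
  | zero => intro R hR hRv; exact H R hR hRv
  | succ n ih =>
    intro R hR hRv
    obtain ⟨Q₀, Q₁, Q₂, ⟨h0, h1, h2⟩, ⟨h0v, h1v, h2v⟩, hsum, -⟩ :=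
      lemma_3_5 hη hT₁ hT₂ (K := D + n) (N := D + (n + 1)) (by omega) (by omega) (by omega)
        (by omega) hR hRv
    rw [← hsum, show D + (n + 1) - (D + n) = 1 by omega]
    simp only [pow_one, map_add, map_mul, ih Q₀ h0 h0v, ih Q₁ h1 h1v, ih Q₂ h2 h2v, mul_zero,
      add_zero]

/-- **Proposition 3.6 (ii), one point.** For `β` not on the line through `(1, ξ, η)` there is
`R ∈ I_D^{(γ,T)}` with `R(β) ≠ 0` (`binom(L+1,2) < T ≤ binom(L+2,2)`, `L < D`).
[cite: Roy2013, Proposition 3.6 (ii)] -/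
theorem exists_mem_vanIdeal_eval_ne_zero {ξ η : ℂ} (hη : η ≠ 0) {L T : ℕ}
    (hT₁ : (L + 1).choose 2 < T) (hT₂ : T ≤ (L + 2).choose 2) (hLD : L < D) {β : Fin 3 → ℂ}
    (hβ0 : β ≠ 0) (hβ : ¬∃ t : ℂ, β = t • ![1, ξ, η]) :
    ∃ R : CX, R.IsHomogeneous D ∧ R ∈ vanIdeal ξ η T ∧ eval β R ≠ 0 := by
  by_contra hne
  have H : ∀ R : CX, R.IsHomogeneous D → R ∈ vanIdeal ξ η T → eval β R = 0 := by
    intro R hR hRv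
    by_contra h
    exact hne ⟨R, hR, hRv, h⟩
  have hall := eval_eq_zero_of_forall_deg hη hT₁ hT₂ hLD H
  -- the elements `(linForm_j)^T X_k^{D}` of degree `T + D`
  have hvan : ∀ (j k : Fin 3), eval β (linForm ξ η j) ^ T * β k ^ D = 0 := by
    intro j k
    have hmem : linForm ξ η j ^ T * X k ^ D ∈ vanIdeal ξ η T :=
      pow_mul_mem_vanIdeal (aeval_one_linForm ξ η j) T _
    have hhom : (linForm ξ η j ^ T * X k ^ D).IsHomogeneous (D + T) := by
      have h := ((isHomogeneous_linForm ξ η j).pow T).mul ((isHomogeneous_X ℂ k).pow D)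
      rw [one_mul, one_mul, add_comm] at h
      exact h
    have h := hall T _ hhom hmem
    rwa [map_mul, map_pow, map_pow, eval_X] at h
  obtain ⟨k, hk⟩ : ∃ k, β k ≠ 0 := by
    by_contra h0
    exact hβ0 (funext fun k => by simpa using not_exists.mp h0 k)
  have hlin : ∀ j : Fin 3, eval β (linForm ξ η j) = 0 := fun j =>
    pow_eq_zero_iff (n := T) (by omega) |>.mp
      ((mul_eq_zero.mp (hvan j k)).resolve_right (pow_ne_zero _ hk))
  have h0 := hlin 0
  have h1 := hlin 1
  have hev := aeval_linForm ξ η β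
  change eval β (linForm ξ η 0) = _ ∧ eval β (linForm ξ η 1) = _ ∧ _ at hev
  rw [hev.1] at h0
  rw [hev.2.1] at h1
  have hβ0' : β 0 ≠ 0 := by
    intro hb
    apply hβ0
    funext i
    fin_cases i
    · exact hb
    · simpa [hb] using h0
    · simpa [hb] using h1
  exact hβ ⟨β 0, funext fun i => by
    fin_cases i
    · simp
    · simp; linear_combination h0
    · simp; linear_combination h1⟩

/-- **Proposition 3.6 (ii).** For finitely many points, none on the line through `(1, ξ, η)`,
there is `R ∈ I_D^{(γ,T)}` vanishing at none of them.
[cite: Roy2013, Proposition 3.6 (ii)] -/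
theorem exists_mem_vanIdeal_forall_eval_ne_zero {ξ η : ℂ} (hη : η ≠ 0) {L T : ℕ}
    (hT₁ : (L + 1).choose 2 < T) (hT₂ : T ≤ (L + 2).choose 2) (hLD : L < D) :
    ∀ S : Finset (Fin 3 → ℂ), (∀ β ∈ S, β ≠ 0) → (∀ β ∈ S, ¬∃ t : ℂ, β = t • ![1, ξ, η]) →
      ∃ R : CX, R.IsHomogeneous D ∧ R ∈ vanIdeal ξ η T ∧ ∀ β ∈ S, eval β R ≠ 0 := by
  classical
  intro S
  induction S using Finset.induction with
  | empty =>
    intro _ _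
    exact ⟨0, isHomogeneous_zero _ _ _, Ideal.zero_mem _, fun β hβ => absurd hβ (notMem_empty β)⟩
  | insert β₀ S hβ₀S ih =>
    intro h0 hline
    obtain ⟨R, hR, hRv, hRne⟩ := ih (fun β hβ => h0 β (mem_insert_of_mem hβ))
      (fun β hβ => hline β (mem_insert_of_mem hβ))
    obtain ⟨R', hR', hR'v, hR'ne⟩ := exists_mem_vanIdeal_eval_ne_zero hη hT₁ hT₂ hLD
      (h0 β₀ (mem_insert_self β₀ S)) (hline β₀ (mem_insert_self β₀ S))
    -- `R + t R'` for `t` outside finitely many bad values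
    let bad : Finset ℂ := insert (-(eval β₀ R) / eval β₀ R') (S.image fun β => -(eval β R) / eval β R')
    obtain ⟨t, ht⟩ := Infinite.exists_notMem_finset bad
    refine ⟨R + C t * R', hR.add (hR'.C_mul t), Ideal.add_mem _ hRv (Ideal.mul_mem_left _ _ hR'v),
      fun β hβ => ?_⟩
    rw [map_add, map_mul, eval_C]
    rcases Finset.mem_insert.mp hβ with rfl | hβS
    · intro h
      apply ht
      rw [Finset.mem_insert]
      left
      rw [eq_div_iff hR'ne]
      linear_combination h
    · intro h
      by_cases hRβ : eval β R' = 0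
      · rw [hRβ, mul_zero, add_zero] at h
        exact hRne β hβS h
      · apply ht
        rw [Finset.mem_insert, Finset.mem_image]
        right
        refine ⟨β, hβS, ?_⟩
        rw [div_eq_iff hRβ]
        linear_combination -h

/-! ### The chart `α₀ ≠ 0` -/

/-- For `α₀ ≠ 0`, `𝒟ⁱP(α) = 0` for `i < T` iff `P ∈ I^{(α', T)}` with `α' = (α₁/α₀, α₂/α₀)`
(homogeneity of the `𝒟ⁱP`). [cite: Roy2013, §3 (the ideal `I^{(γ,T)}`) and §6] -/
theorem mem_vanIdeal_iff_of_ne_zero {P : CX} {n : ℕ} (hP : P.IsHomogeneous n) {α : Fin 3 → ℂ}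
    (hα : α 0 ≠ 0) (T : ℕ) :
    P ∈ vanIdeal (α 1 / α 0) (α 2 / α 0) T ↔ ∀ i < T, eval α (homD^[i] P) = 0 := by
  have hsm : α = α 0 • ![1, α 1 / α 0, α 2 / α 0] := by
    funext i; fin_cases i
    · simp
    · simp; field_simp
    · simp; field_simp
  rw [mem_vanIdeal_iff]
  refine forall_congr' fun i => imp_congr_right fun _ => ?_
  have h : eval (α 0 • ![1, α 1 / α 0, α 2 / α 0]) (homD^[i] P) =
      α 0 ^ n * eval ![1, α 1 / α 0, α 2 / α 0] (homD^[i] P) :=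
    aeval_smul_of_isHomogeneous (isHomogeneous_iterate_homD hP i) (α 0) ![1, α 1 / α 0, α 2 / α 0]
  rw [← hsm] at h
  change eval ![1, α 1 / α 0, α 2 / α 0] (homD^[i] P) = 0 ↔ _
  rw [h, mul_eq_zero, or_iff_right (pow_ne_zero _ hα)]

/-! ### The multiplicity `eᵢ ≥ T` -/

/-- Points of `𝒵(P, Q)` other than `αᵢ` are not on the line through `αᵢ`. [folklore] -/
theorem not_prop_chart {m : ℕ} {α : Fin m → (Fin 3 → ℂ)}
    (hsep : ∀ i j, i ≠ j → ¬∃ t : ℂ, α j = t • α i) {i j : Fin m} (hij : i ≠ j)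
    (hαi : α i 0 ≠ 0) : ¬∃ t : ℂ, α j = t • ![1, α i 1 / α i 0, α i 2 / α i 0] := by
  rintro ⟨t, ht⟩
  refine hsep i j hij ⟨t / α i 0, ?_⟩
  rw [ht]
  funext k; fin_cases k <;> simp <;> field_simp

/-- Order of vanishing at `0` of `X^e · u` with `u(0) ≠ 0`. [folklore] -/
theorem le_of_X_pow_dvd_X_pow_mul {u : Polynomial ℂ} (hu : u.eval 0 ≠ 0) {e T : ℕ}
    (h : (Polynomial.X : Polynomial ℂ) ^ T ∣ Polynomial.X ^ e * u) : T ≤ e := by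
  by_contra hlt
  have h1 : (Polynomial.X : Polynomial ℂ) ^ (e + 1) ∣ Polynomial.X ^ e * u :=
    (pow_dvd_pow _ (by omega)).trans h
  rw [pow_succ, mul_dvd_mul_iff_left (pow_ne_zero _ Polynomial.X_ne_zero),
    Polynomial.X_dvd_iff, Polynomial.coeff_zero_eq_eval_zero] at h1
  exact hu h1

/-- **Roy 2013, proof of Proposition 6.4: `eᵢ ≥ T`.** In the factorisation `F = c ∏ ℓ_{αⱼ}^{eⱼ}`
of `F = Φ(P, Q, ·)` (`royF_eq_C_mul_prod`), if `P, Q ∈ I^{(αᵢ, T)}` for a representative `αᵢ` with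
`αᵢ₀ αᵢ₂ ≠ 0` and `binom(L+1,2) < T ≤ binom(L+2,2)`, `L < D`, then `T ≤ eᵢ`: take `R ∈ I_D^{(αᵢ,T)}`
avoiding the other `αⱼ` (Prop. 3.6 (ii)) and `S = X₀^D`; along the line `R + zS` the function
`Φ(P, Q, ·)` vanishes to order `≥ T` (Corollary 5.7 for `Φ`) and to order exactly `eᵢ`.
[cite: Roy2013, §6, proof of Proposition 6.4] -/
theorem le_mult_of_mem_vanIdeal {P Q : CX} (hP : P.IsHomogeneous D) (hQ : Q.IsHomogeneous D)
    (hM₁ : ∀ μ ∈ M₁, μ.degree = 2 * D) (hM₂ : ∀ μ ∈ M₂, μ.degree = 2 * D)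
    (σ : PhiCol D M₁ M₂ ≃ PhiRow D)
    {m : ℕ} {α : Fin m → (Fin 3 → ℂ)} (hα0 : ∀ i, α i ≠ 0)
    (hsep : ∀ i j, i ≠ j → ¬∃ t : ℂ, α j = t • α i)
    {c : ℂ} (hc : c ≠ 0) {e : Fin m → ℕ}
    (hFeq : royF D M₁ M₂ σ P Q = C c * ∏ i, evalForm D (α i) ^ e i)
    {L T : ℕ} (hT₁ : (L + 1).choose 2 < T) (hT₂ : T ≤ (L + 2).choose 2) (hLD : L < D)
    {i : Fin m} (hαi0 : α i 0 ≠ 0) (hαi2 : α i 2 ≠ 0)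
    (hPv : P ∈ vanIdeal (α i 1 / α i 0) (α i 2 / α i 0) T)
    (hQv : Q ∈ vanIdeal (α i 1 / α i 0) (α i 2 / α i 0) T) : T ≤ e i := by
  classical
  have hη : α i 2 / α i 0 ≠ 0 := div_ne_zero hαi2 hαi0
  have hT0 : 1 ≤ T := by have := Nat.zero_le ((L + 1).choose 2); omega
  -- `R ∈ I_D^{(αᵢ,T)}` avoiding the other points
  obtain ⟨R, hR, hRv, hRne⟩ := exists_mem_vanIdeal_forall_eval_ne_zero hη hT₁ hT₂ hLD
    ((univ.filter fun j => j ≠ i).image α)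
    (fun β hβ => by
      obtain ⟨j, -, rfl⟩ := Finset.mem_image.mp hβ; exact hα0 j)
    (fun β hβ => by
      obtain ⟨j, hj, rfl⟩ := Finset.mem_image.mp hβ
      exact not_prop_chart hsep (Ne.symm (Finset.mem_filter.mp hj).2) hαi0)
  have hRne' : ∀ j, j ≠ i → eval (α j) R ≠ 0 := fun j hj =>
    hRne (α j) (Finset.mem_image.mpr ⟨j, Finset.mem_filter.mpr ⟨mem_univ j, hj⟩, rfl⟩)
  have hRi : eval (α i) R = 0 := by
    have h := (mem_vanIdeal_iff_of_ne_zero hR hαi0 T).mp hRv 0 (by omega)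
    simpa using h
  -- Corollary 5.7 for `Φ` along the line `R + t X₀^D`
  have hT3 : T ≤ (3 * D + 2).choose 2 := hT₂.trans (Nat.choose_le_choose 2 (by omega))
  obtain ⟨p, hpdvd, hpeval⟩ := royPhi_line_multiplicity (D := D) hη hT3 hM₁ hM₂ σ
    (Qs := ![P, Q, R]) (Fin.forall_fin_succ.mpr ⟨hP, Fin.forall_fin_two.mpr ⟨hQ, hR⟩⟩)
    (Fin.forall_fin_succ.mpr ⟨hPv, Fin.forall_fin_two.mpr ⟨hQv, hRv⟩⟩) ![0, 0, X 0 ^ D]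
  -- the value along the line, computed from the factorisation
  set p' : Polynomial ℂ := Polynomial.C c *
    ∏ j, (Polynomial.C (eval (α j) R) + Polynomial.X * Polynomial.C (α j 0 ^ D)) ^ e j with hp'
  have hline : ∀ t : ℂ, ![P, Q, R] + t • (![0, 0, X 0 ^ D] : Fin 3 → CX) =
      ![P, Q, R + C t * X 0 ^ D] := by
    intro t; funext j; fin_cases j <;> simp [smul_eq_C_mul]
  have hval : ∀ t : ℂ, p.eval t = p'.eval t := by
    intro t
    have hRt : (R + C t * X 0 ^ D).IsHomogeneous D := by
      have h := ((isHomogeneous_X ℂ (0 : Fin 3)).pow D).C_mul t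
      rw [one_mul] at h
      exact hR.add h
    rw [← hpeval, hline, ← eval_royF hM₁ hM₂ σ P Q, hFeq, map_mul, eval_C, map_prod, hp',
      Polynomial.eval_mul, Polynomial.eval_C, Polynomial.eval_prod]
    congr 1
    refine Finset.prod_congr rfl fun j _ => ?_
    rw [map_pow, Polynomial.eval_pow, eval_evalForm_coeff hRt, map_add, map_mul, eval_C, map_pow,
      eval_X, Polynomial.eval_add, Polynomial.eval_mul, Polynomial.eval_C, Polynomial.eval_X,
      Polynomial.eval_C]
  have hpp' : p = p' := Polynomial.funext hval
  -- order of vanishing of `p'` at `0` is exactly `eᵢ`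
  set a : ℂ := α i 0 ^ D with ha
  have ha0 : a ≠ 0 := pow_ne_zero _ hαi0
  set rest : Polynomial ℂ := ∏ j ∈ univ.erase i,
    (Polynomial.C (eval (α j) R) + Polynomial.X * Polynomial.C (α j 0 ^ D)) ^ e j with hrest
  have hfac : (Polynomial.C (eval (α i) R) + Polynomial.X * Polynomial.C a) ^ e i =
      Polynomial.X ^ e i * Polynomial.C (a ^ e i) := by
    rw [hRi, map_zero, zero_add, mul_pow, ← Polynomial.C_pow]
  have hp'eq : p' = Polynomial.X ^ e i * (Polynomial.C (c * a ^ e i) * rest) := by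
    rw [hp', ← Finset.mul_prod_erase univ
      (fun j => (Polynomial.C (eval (α j) R) + Polynomial.X * Polynomial.C (α j 0 ^ D)) ^ e j)
      (mem_univ i)]
    change Polynomial.C c * ((Polynomial.C (eval (α i) R) + Polynomial.X * Polynomial.C a) ^ e i *
      rest) = _
    rw [hfac, Polynomial.C_mul]
    ring
  have hu : (Polynomial.C (c * a ^ e i) * rest).eval 0 ≠ 0 := by
    rw [Polynomial.eval_mul, Polynomial.eval_C, hrest, Polynomial.eval_prod]
    refine mul_ne_zero (mul_ne_zero hc (pow_ne_zero _ ha0)) (prod_ne_zero_iff.mpr fun j hj => ?_)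
    rw [Polynomial.eval_pow]
    refine pow_ne_zero _ ?_
    rw [Polynomial.eval_add, Polynomial.eval_mul, Polynomial.eval_C, Polynomial.eval_X,
      Polynomial.eval_C, zero_mul, add_zero]
    exact hRne' j (Finset.ne_of_mem_erase hj)
  rw [hpp', hp'eq] at hpdvd
  exact le_of_X_pow_dvd_X_pow_mul hu hpdvd

end Roy2013

end Literature.NumberTheory.Transcendental
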